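import Summits.ResolutionOfSingularities.ResolutionOfSingularities.Theorems.MarkedTransferCampaignW13BypassRFlatFailure
import Literature.AlgebraicGeometry.Resolution.HasseSchmidtDiffEqDiffOp
import HarnessLib

/-!
# [OURS · L1 W1.3] The arc criterion for `℘_alg(((g), b), 1)` at EVERY exponent `b` (Hasse–Schmidt form), and the
# singular-arc criterion: arcs inside the order-`≥ b` locus kill `℘(Ě,1)` (seat res-L1-s13-pv-1, g2)

LADDER-RESOLUTION rung L (rescue), cell `res-hironaka`, RESCUE-SEED slot W1.3 (architecture bypass, reading R-flat), F7′ row 1.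
p481686 `W13.not_mem_pAlgPiece_one_of_arc` certifies NON-membership in the bound algebraic `℘(((g),2),1)` (row 003 U17_2:
degree-1 piece of the integral closure of `O[⊕_{j<b} Diff^{(j)}((g))·X^{b−j}]`, `b = 2`) by an arc; it was written for
`b = 2` because only order-`≤ 1` operators were available as `(multiplication) + (derivation)`. With the tree's EGA IV₄
16.11.2 for affine space (`Literature.AlgebraicGeometry.Resolution.diffOp_le_hasseSchmidtDiff`: every `K`-linear
differential operator of order `≤ n` on `K[x_σ]`, `σ` finite, is a `K[x]`-combination of Hasse–Schmidt derivatives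
`D^{(α)}`, `|α| ≤ n`) and the Leibniz rule `hasseDeriv_mul`, the same argument runs for EVERY `b`:

* `pow_dvd_map_of_mem_diffIdeal`: if a ring map `φ : K[x_σ] → K[t]` has `θ^{b−|α|} ∣ φ(D^{(α)}g)` for all `|α| < b`,
  then `θ^{b−j} ∣ φ(c)` for every `c ∈ Diff^{(j)}((g))`, `j < b`;
* `map_diffSubalgebra_mem_twist_general`: hence `φ` maps the Diff-subalgebra of `Ě = ((g), b)` into the Rees algebra
  `K[t][θX]` (tree `twistSubalgebra`);
* **`not_mem_pAlgPiece_one_of_arc_general`**: so an element `c` with `θ ∤ φ(c)` (`θ ≠ 0`) is NOT in `℘_alg(((g),b),1)`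
  (Huneke–Swanson 5.2.1/1.5.2, tree `mem_twistSubalgebra_of_isIntegral_twist`, exactly as in p481686);
* **`not_mem_pAlgPiece_one_of_singArc_general`** / `map_eq_zero_of_mem_pAlgPiece_one_general`: if `φ(D^{(α)}g) = 0`
  for ALL `|α| < b` — an arc inside the order-`≥ b` locus `top(g, b)` — then every element of `℘_alg(((g),b),1)` vanishes
  along `φ`; with a unit multiplier `s` (`φ(s) ≠ 0`) the same holds for `c` with `s·c^n ∈ ℘` (stalk form).

USE (companion file `…W13RFlatCanonicalPosOddP.lean`): the rung-1 content Prop on `𝒞_can` fails at `p = 3` as well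
(`u³ + z³·(xz² + xyz + xy² − yz² − y²z)`, arc `(t,t,t,−t²)`), so the R-flat failure is NOT a characteristic-2
phenomenon. HONEST FRAMING. OURS statements about the OURS bypass objects (bound algebraic `℘`; candidate U17_4 not used);
nothing here is a statement of H. Hironaka's manuscript [Hironaka2017] (2017-03-23, lit key `paper:url-3343fd9e678b`); no
claim about resolution of singularities in positive characteristic; AI bookkeeping weaker than expert review. All decls
`[folklore]`, sorry-free.
-/

noncomputable section

set_option linter.dupNamespace false -- mandated namespace of this single-conjunct summit

namespace Summit.ResolutionOfSingularities.ResolutionOfSingularities.Theorems.Campaign.W13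

open MvPolynomial
open Literature.AlgebraicGeometry.Resolution
open Literature.AlgebraicGeometry.Hironaka2017
open Literature.AlgebraicGeometry.Hironaka2017.S04CharAlgebra (diffSubalgebra pAlgebraicRing)
open Literature.RingTheory.IntegralClosure (twistSubalgebra mem_twistSubalgebra_iff
  mem_twistSubalgebra_of_isIntegral_twist)

universe u

section ArcGeneral

open Polynomial (C)

variable (K : Type u) [Field K] {σ : Type} [Fintype σ] [DecidableEq σ]

/-- **Hasse–Schmidt control of `Diff^{(j)}((g))` along an arc.** If `θ^{b−|α|} ∣ φ(D^{(α)} g)` for every multi-index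
`α` with `|α| < b`, then `θ^{b−j} ∣ φ(c)` for every `c ∈ Diff^{(j)}((g))`, `j < b`: an operator of order `≤ j` is
`Σ_{|α|≤j} a_α D^{(α)}` (tree `diffOp_le_hasseSchmidtDiff`, EGA IV₄ 16.11.2) and `D^{(α)}(hg) = Σ_{β+γ=α} D^{(β)}h·D^{(γ)}g`
(`hasseDeriv_mul`) with `|γ| ≤ |α| ≤ j`. [folklore] -/
theorem pow_dvd_map_of_mem_diffIdeal (φ : MvPolynomial σ K →+* Polynomial K) (θ : Polynomial K)
    (g : MvPolynomial σ K) (b : ℕ)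
    (hd : ∀ α : σ →₀ ℕ, α.degree < b → θ ^ (b - α.degree) ∣ φ (hasseDeriv K α g))
    {j : ℕ} (hj : j < b) {c : MvPolynomial σ K} (hc : c ∈ diffIdeal K j (Ideal.span {g})) :
    θ ^ (b - j) ∣ φ c := by
  have key : diffIdeal K j (Ideal.span {g}) ≤ (Ideal.span {θ ^ (b - j)}).comap φ := by
    refine (diffIdeal_le_iff K).mpr fun D hD f hf => ?_
    have hDspan : D ∈ HasseSchmidtDiff σ K j := diffOp_le_hasseSchmidtDiff K j hD
    -- induction over the `K[x]`-span of the Hasse–Schmidt derivatives of order `≤ j`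
    suffices h : ∀ D ∈ HasseSchmidtDiff σ K j, ∀ f ∈ Ideal.span {g}, D f ∈ (Ideal.span {θ ^ (b - j)}).comap φ from
      h D hDspan f hf
    intro D hD
    refine Submodule.span_induction ?_ ?_ ?_ ?_ hD
    · rintro _ ⟨α, hα, rfl⟩ f hf
      obtain ⟨a, rfl⟩ := Ideal.mem_span_singleton'.mp hf
      rw [Ideal.mem_comap, hasseDeriv_mul, map_sum]
      refine Ideal.sum_mem _ fun q hq => ?_
      have hq' : q.1 + q.2 = α := Finset.mem_antidiagonal.mp hq
      have hdeg : q.2.degree ≤ α.degree := by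
        rw [← hq', map_add]; exact Nat.le_add_left _ _
      have hlt : q.2.degree < b := lt_of_le_of_lt (hdeg.trans hα) hj
      rw [map_mul]
      refine Ideal.mul_mem_left _ _ (Ideal.mem_span_singleton.mpr ?_)
      exact (pow_dvd_pow θ (by omega)).trans (hd q.2 hlt)
    · intro f _; simp
    · intro D₁ D₂ _ _ h₁ h₂ f hf
      rw [LinearMap.add_apply, Ideal.mem_comap, map_add]
      exact Ideal.add_mem _ (h₁ f hf) (h₂ f hf)
    · intro r D _ h f hf
      rw [LinearMap.smul_apply, smul_eq_mul, Ideal.mem_comap, map_mul]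
      exact Ideal.mul_mem_left _ _ (h f hf)
  exact Ideal.mem_span_singleton.mp (key hc)

/-- Hence `φ` maps the Diff-subalgebra `O[⊕_{j<b} Diff^{(j)}((g))·X^{b−j}]` of `Ě = ((g), b)` (row 003 `diffSubalgebra`)
into the Rees algebra `K[t][θX]` (`θ^a ∣ coeff_a`). [folklore] -/
theorem map_diffSubalgebra_mem_twist_general (φ : MvPolynomial σ K →+* Polynomial K) (θ : Polynomial K)
    (g : MvPolynomial σ K) (b : ℕ)
    (hd : ∀ α : σ →₀ ℕ, α.degree < b → θ ^ (b - α.degree) ∣ φ (hasseDeriv K α g)) :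
    ∀ x ∈ diffSubalgebra K (MvPolynomial σ K) (Ideal.span {g}) b,
      Polynomial.map φ x ∈ twistSubalgebra θ := by
  intro x hx
  induction hx using Algebra.adjoin_induction with
  | mem x hx =>
    obtain ⟨j, hj, c, hc, rfl⟩ := hx
    rw [Polynomial.map_monomial, mem_twistSubalgebra_iff]
    intro a
    rw [Polynomial.coeff_monomial]
    split_ifs with h
    · subst h
      exact pow_dvd_map_of_mem_diffIdeal K φ θ g b hd hj hc
    · exact dvd_zero _
  | algebraMap r =>
    rw [Polynomial.algebraMap_apply, Polynomial.map_C, mem_twistSubalgebra_iff]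
    intro a
    rw [Polynomial.coeff_C]
    split_ifs with h
    · subst h; simp
    · exact dvd_zero _
  | add x y _ _ hx hy => rw [Polynomial.map_add]; exact Subalgebra.add_mem _ hx hy
  | mul x y _ _ hx hy => rw [Polynomial.map_mul]; exact Subalgebra.mul_mem _ hx hy

/-- **Arc criterion for `℘_alg(((g),b),1)`, every `b` (NEG certificate, kernel form).** With `φ : K[x_σ] → K[t]`,
`θ ≠ 0`, and `θ^{b−|α|} ∣ φ(D^{(α)}g)` for all `|α| < b` (for `α = 0`: `θ^b ∣ φ(g)`): an element `c` with `θ ∤ φ(c)`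
is NOT in the degree-`1` piece of the bound algebraic characteristic algebra of `((g), b)` — `c·X`, integral over the
Diff-subalgebra, would map to an element of `K[t][X]` integral over `K[t][θX]`, hence inside it (Huneke–Swanson
5.2.1/1.5.2), forcing `θ ∣ φ(c)`. Generalises p481686 (`b = 2`). [folklore] -/
theorem not_mem_pAlgPiece_one_of_arc_general (φ : MvPolynomial σ K →+* Polynomial K) {θ : Polynomial K}
    (hθ : θ ≠ 0) (g : MvPolynomial σ K) (b : ℕ)
    (hd : ∀ α : σ →₀ ℕ, α.degree < b → θ ^ (b - α.degree) ∣ φ (hasseDeriv K α g))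
    {c : MvPolynomial σ K} (hc : ¬ θ ∣ φ c) : c ∉ Campaign.pAlgPiece K (Ideal.span {g}) b 1 := by
  intro hmem
  rw [mem_pAlgPiece_iff, pAlgebraicRing, Subalgebra.mem_restrictScalars, mem_integralClosure_iff] at hmem
  set D := diffSubalgebra K (MvPolynomial σ K) (Ideal.span {g}) b with hD
  let ψ : Polynomial (MvPolynomial σ K) →+* Polynomial (Polynomial K) := Polynomial.mapRingHom φ
  have hψD : ∀ x : D, ψ (x : Polynomial (MvPolynomial σ K)) ∈ twistSubalgebra θ := fun x =>
    map_diffSubalgebra_mem_twist_general K φ θ g b hd x x.2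
  let ρ : D →+* twistSubalgebra θ :=
    (ψ.comp (Subalgebra.val D).toRingHom).codRestrict (twistSubalgebra θ).toSubring.toSubsemiring
      (fun x => hψD x)
  have hρ : ∀ x : D, ((ρ x : twistSubalgebra θ) : Polynomial (Polynomial K)) =
      ψ (x : Polynomial (MvPolynomial σ K)) := fun x => rfl
  obtain ⟨P, hPmonic, hPx⟩ := hmem
  have hint : IsIntegral (twistSubalgebra θ) (ψ (Polynomial.monomial 1 c)) := by
    refine ⟨P.map ρ, hPmonic.map ρ, ?_⟩
    have h1 : (algebraMap (twistSubalgebra θ) (Polynomial (Polynomial K))).comp ρ =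
        ψ.comp (algebraMap D (Polynomial (MvPolynomial σ K))) := RingHom.ext fun x => hρ x
    rw [Polynomial.eval₂_map, h1, ← Polynomial.hom_eval₂, hPx, map_zero]
  have hψx : ψ (Polynomial.monomial 1 c) ∈ twistSubalgebra θ := mem_twistSubalgebra_of_isIntegral_twist hθ hint
  have := (mem_twistSubalgebra_iff.mp hψx) 1
  rw [show ψ (Polynomial.monomial 1 c) = Polynomial.monomial 1 (φ c) from Polynomial.map_monomial φ,
    Polynomial.coeff_monomial, if_pos rfl, pow_one] at this
  exact hc this

/-- **Singular-arc criterion, every `b`.** If `φ(D^{(α)}g) = 0` for ALL `|α| < b` — the arc lies in the order-`≥ b`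
locus of `g` — then every `c` with `φ(c) ≠ 0` is outside `℘_alg(((g),b),1)` (`θ = t^{deg φ(c)+1}`). [folklore] -/
theorem not_mem_pAlgPiece_one_of_singArc_general (φ : MvPolynomial σ K →+* Polynomial K) (g : MvPolynomial σ K)
    (b : ℕ) (hd : ∀ α : σ →₀ ℕ, α.degree < b → φ (hasseDeriv K α g) = 0) {c : MvPolynomial σ K}
    (hc : φ c ≠ 0) : c ∉ Campaign.pAlgPiece K (Ideal.span {g}) b 1 := by
  refine not_mem_pAlgPiece_one_of_arc_general K φ (θ := (Polynomial.X : Polynomial K) ^ ((φ c).natDegree + 1))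
    (pow_ne_zero _ Polynomial.X_ne_zero) g b (fun α hα => ?_) ?_
  · rw [hd α hα]; exact dvd_zero _
  · intro h
    have h1 := Polynomial.natDegree_le_of_dvd h hc
    rw [Polynomial.natDegree_X_pow] at h1
    omega

/-- Contrapositive: `℘_alg(((g),b),1)` lies in the ideal of every arc of the order-`≥ b` locus. [folklore] -/
theorem map_eq_zero_of_mem_pAlgPiece_one_general (φ : MvPolynomial σ K →+* Polynomial K) (g : MvPolynomial σ K)
    (b : ℕ) (hd : ∀ α : σ →₀ ℕ, α.degree < b → φ (hasseDeriv K α g) = 0) {c : MvPolynomial σ K}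
    (hc : c ∈ Campaign.pAlgPiece K (Ideal.span {g}) b 1) : φ c = 0 := by
  by_contra h
  exact not_mem_pAlgPiece_one_of_singArc_general K φ g b hd h hc

/-- Stalk form: if `s·c^n ∈ ℘_alg(((g),b),1)` with `φ(s) ≠ 0` and `n ≥ 1`, then `φ(c) = 0`. [folklore] -/
theorem map_eq_zero_of_mul_pow_mem_pAlgPiece_one_general (φ : MvPolynomial σ K →+* Polynomial K)
    (g : MvPolynomial σ K) (b : ℕ) (hd : ∀ α : σ →₀ ℕ, α.degree < b → φ (hasseDeriv K α g) = 0)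
    {s c : MvPolynomial σ K} {n : ℕ} (hmem : s * c ^ n ∈ Campaign.pAlgPiece K (Ideal.span {g}) b 1)
    (hs : φ s ≠ 0) (hn : n ≠ 0) : φ c = 0 := by
  have h := map_eq_zero_of_mem_pAlgPiece_one_general K φ g b hd hmem
  rw [map_mul, map_pow] at h
  rcases mul_eq_zero.mp h with h | h
  · exact absurd h hs
  · exact (pow_eq_zero_iff hn).mp h

omit [Fintype σ] [DecidableEq σ] in
/-- **Taylor form of the hypothesis.** `φ(D^{(α)}g)` is the `v^α`-coefficient of `g(γ + v)`, where `γ = (φ(x_i))_i` is the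
arc: `aeval γ (D^{(α)} g) = coeff_α (aeval (x_i ↦ C(γ_i) + v_i) g)` (tree `hasseDeriv_apply`, `taylor`). So «`φ` kills all
`D^{(α)}g`, `|α| < b`» is «`g(γ + v) ∈ (v)^b`». [folklore] -/
theorem aeval_hasseDeriv_eq_coeff_taylor (γ : σ → Polynomial K) (g : MvPolynomial σ K) (α : σ →₀ ℕ) :
    MvPolynomial.aeval γ (hasseDeriv K α g) =
      coeff α (MvPolynomial.aeval (R := K)
        (fun i => (MvPolynomial.C (γ i) : MvPolynomial σ (Polynomial K)) + X i) g) := by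
  let f : MvPolynomial σ K →+* Polynomial K := (MvPolynomial.aeval γ).toRingHom
  have hcomp : (MvPolynomial.map (σ := σ) f).comp (taylor K : MvPolynomial σ K →ₐ[K] _).toRingHom =
      (MvPolynomial.aeval (R := K)
        (fun i => (MvPolynomial.C (γ i) : MvPolynomial σ (Polynomial K)) + X i)).toRingHom := by
    refine MvPolynomial.ringHom_ext (fun k => ?_) (fun i => ?_)
    · simp only [RingHom.coe_comp, Function.comp_apply, AlgHom.toRingHom_eq_coe, AlgHom.coe_toRingHom, taylor_C,
        MvPolynomial.map_C, MvPolynomial.aeval_C, MvPolynomial.algebraMap_apply]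
      simp [f]
    · simp [f]
  have h' : MvPolynomial.map f (taylor K g) =
      MvPolynomial.aeval (R := K) (fun i => (MvPolynomial.C (γ i) : MvPolynomial σ (Polynomial K)) + X i) g := by
    simpa using RingHom.congr_fun hcomp g
  rw [hasseDeriv_apply, ← h', MvPolynomial.coeff_map]
  rfl

omit [Fintype σ] [DecidableEq σ] in
/-- Hence: if `g(γ + v)` lies in the `b`-th power of the ideal `(v_i)_i` of `K[t][v_σ]` (Mathlib `idealOfVars`), then
`φ = aeval γ` kills every `D^{(α)}g`, `|α| < b` — the arc `γ` lies in the order-`≥ b` locus of `g`. [folklore] -/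
theorem aeval_hasseDeriv_eq_zero_of_mem_pow (γ : σ → Polynomial K) (g : MvPolynomial σ K) (b : ℕ)
    (hmem : MvPolynomial.aeval (R := K)
      (fun i => (MvPolynomial.C (γ i) : MvPolynomial σ (Polynomial K)) + X i) g ∈
        idealOfVars σ (Polynomial K) ^ b) :
    ∀ α : σ →₀ ℕ, α.degree < b → MvPolynomial.aeval γ (hasseDeriv K α g) = 0 := by
  intro α hα
  rw [aeval_hasseDeriv_eq_coeff_taylor]
  exact (mem_pow_idealOfVars_iff' b _).mp hmem α hα

end ArcGeneral

end Summit.ResolutionOfSingularities.ResolutionOfSingularities.Theorems.Campaign.W13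

end
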